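import Mathlib
import Summits.MatrixMultiplication.MatrixMultiplication.Theorems.LevelGradedCohnUmansLevelOneGL2DesignsStubTangencySetsTabuRecords

/-!
# The siege plan's registered census sub-stubs, closed by name from the landed records

The siege plan (round 2, DECOMPOSITIONS.md rev 2) of the crux `LevelOneGL2Designs`
(stmt-MatrixMultiplication-14080) registered certificate-shaped sub-stubs of `stub_tangencySets`,
`stub_tangencyAt_p_N : ∃ S ⊆ 𝔽_p² × 𝔽_p², N ≤ |S| ∧ (x_f ⬝ y_{f'} = 1 ↔ f = f')`, at the thresholds
`17:59, 19:69, 23:91, 31:134, 47:231` (and `29:128, 37:187`, still open).  Stronger records have since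
landed under OTHER names — `TabuRecords.stub_tangencyAt_17_64 / _19_72 / _23_96 / _31_135 / _47_240`
(wall-breaker k1, tabu search) — so the plan's stubs are one `le_trans` away; this file lands them
VERBATIM (the registry matches name + signature); `29:128` and `37:187` stay open (best certified:
126 in `…CertifiedTable`, 185 in this seat's `…TangencySingerInstances`).  No computation is repeated;
no definitions. (Wall-breaker axis k12: random-algebraic constructions with certified small instances.)
-/

set_option linter.dupNamespace false

namespace Summit.MatrixMultiplication.MatrixMultiplication.Theorems.LevelOneGL2Designs.TangencyRandAlg

open Summit.MatrixMultiplication.MatrixMultiplication.Theorems.LevelOneGL2Designs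

/-- Siege-plan sub-stub `stub_tangencyAt_17_59` (verbatim), from the landed record `T(17) ≥ 64`
(`TabuRecords.stub_tangencyAt_17_64`). [bookkeeping] -/
theorem stub_tangencyAt_17_59 :
    ∃ S : Finset ((Fin 2 → ZMod 17) × (Fin 2 → ZMod 17)), 59 ≤ S.card ∧
      ∀ f ∈ S, ∀ f' ∈ S, (dotProduct f.1 f'.2 = 1 ↔ f = f') := by
  obtain ⟨S, h, hS⟩ := TabuRecords.stub_tangencyAt_17_64
  exact ⟨S, le_trans (by norm_num) h, hS⟩

/-- Siege-plan sub-stub `stub_tangencyAt_19_69` (verbatim), from the landed record `T(19) ≥ 72`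
(`TabuRecords.stub_tangencyAt_19_72`). [bookkeeping] -/
theorem stub_tangencyAt_19_69 :
    ∃ S : Finset ((Fin 2 → ZMod 19) × (Fin 2 → ZMod 19)), 69 ≤ S.card ∧
      ∀ f ∈ S, ∀ f' ∈ S, (dotProduct f.1 f'.2 = 1 ↔ f = f') := by
  obtain ⟨S, h, hS⟩ := TabuRecords.stub_tangencyAt_19_72
  exact ⟨S, le_trans (by norm_num) h, hS⟩

/-- Siege-plan sub-stub `stub_tangencyAt_23_91` (verbatim), from the landed record `T(23) ≥ 96`
(`TabuRecords.stub_tangencyAt_23_96`). [bookkeeping] -/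
theorem stub_tangencyAt_23_91 :
    ∃ S : Finset ((Fin 2 → ZMod 23) × (Fin 2 → ZMod 23)), 91 ≤ S.card ∧
      ∀ f ∈ S, ∀ f' ∈ S, (dotProduct f.1 f'.2 = 1 ↔ f = f') := by
  obtain ⟨S, h, hS⟩ := TabuRecords.stub_tangencyAt_23_96
  exact ⟨S, le_trans (by norm_num) h, hS⟩

/-- Siege-plan sub-stub `stub_tangencyAt_31_134` (verbatim), from the landed record `T(31) ≥ 135`
(`TabuRecords.stub_tangencyAt_31_135`). [bookkeeping] -/
theorem stub_tangencyAt_31_134 :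
    ∃ S : Finset ((Fin 2 → ZMod 31) × (Fin 2 → ZMod 31)), 134 ≤ S.card ∧
      ∀ f ∈ S, ∀ f' ∈ S, (dotProduct f.1 f'.2 = 1 ↔ f = f') := by
  obtain ⟨S, h, hS⟩ := TabuRecords.stub_tangencyAt_31_135
  exact ⟨S, le_trans (by norm_num) h, hS⟩

/-- Siege-plan sub-stub `stub_tangencyAt_47_231` (verbatim), from the landed record `T(47) ≥ 240`
(`TabuRecords.stub_tangencyAt_47_240`; the same value 240 = 0.745·47^{3/2} is reached independently by
this seat's Singer 6×37-coset union of PG(2,47) plus 18 annealed flags, kit j020393). [bookkeeping] -/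
theorem stub_tangencyAt_47_231 :
    ∃ S : Finset ((Fin 2 → ZMod 47) × (Fin 2 → ZMod 47)), 231 ≤ S.card ∧
      ∀ f ∈ S, ∀ f' ∈ S, (dotProduct f.1 f'.2 = 1 ↔ f = f') := by
  obtain ⟨S, h, hS⟩ := TabuRecords.stub_tangencyAt_47_240
  exact ⟨S, le_trans (by norm_num) h, hS⟩

end Summit.MatrixMultiplication.MatrixMultiplication.Theorems.LevelOneGL2Designs.TangencyRandAlg
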